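import Mathlib.Analysis.Complex.CauchyIntegral
import Mathlib.Analysis.Calculus.IteratedDeriv.Lemmas
import Mathlib.Analysis.Calculus.Deriv.Star
import Mathlib.Algebra.Polynomial.Eval.Defs
import HarnessLib

/-!
# Polynomial differential operators `p(a d/ds)` and the reflection `F ↦ conj F(1 − s̄)`

Trunk T-ANALYSIS support (`Literature/Analysis/Complex`). The functions of Levinson's method are
obtained from `ζ` (or from Riemann's auxiliary function `𝓡`) by polynomial differential operators
in `−L⁻¹ d/ds` (Levinson 1974: `ζ + ζ'/L`; Conrey, *J. Number Theory* 16 (1983), §4: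
`c(z) = 𝜙(L⁻¹ log z)` inserted under Siegel's integral, i.e. `𝜙(−L⁻¹ d/ds)` applied to `𝓡(s)`,
since `(−d/ds) z^{−s} = (log z) z^{−s}`; Pratt–Robles–Zaharescu–Zeindler 2020, §1.3:
`V(s) = Q(−L⁻¹ d/ds) ζ(s)`). We define, for a real polynomial `p = Σ pₖ Xᵏ`, a real scale `a` and a
function `F : ℂ → ℂ`,

  `polyDerivOp p a F s = Σₖ pₖ aᵏ F⁽ᵏ⁾(s)`   ("`p(a d/ds) F`"),

and prove the two rules on which Conrey's identity `K ξ = Q + Q♯` (loc. cit. (1)) rests: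

* linearity in `p` and `polyDerivOp (C c) a F = c • F` (`polyDerivOp_add`, `polyDerivOp_C`);
* the **reflection rule**: with `F♯(s) = conj F(1 − s̄)` (reflection in the critical line), for
  entire `F`, `(F♯)⁽ᵏ⁾(s) = (−1)ᵏ conj F⁽ᵏ⁾(1 − s̄)` (`iteratedDeriv_conj_one_sub_conj`), hence
  `conj (p(a d/ds) F)(1 − s̄) = (p(−a d/ds) F♯)(s)` (`conj_polyDerivOp_one_sub_conj`): reflecting
  turns `p(−δ/L)` into `p(δ/L)`.

## References

* J. B. Conrey, *Zeros of derivatives of Riemann's ξ-function on the critical line*, J. Number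
  Theory 16 (1983), 49–74, §4. [Conrey1983]
* N. Levinson, *More than one third of zeros of Riemann's zeta-function are on `σ = 1/2`*,
  Adv. Math. 13 (1974), 383–436, §1.
-/

noncomputable section

open Complex Polynomial
open scoped ComplexConjugate

namespace Literature.Analysis.Complex

/-- **The polynomial differential operator `p(a d/ds)`**: for `p = Σ pₖ Xᵏ ∈ ℝ[X]`, `a ∈ ℝ` and
`F : ℂ → ℂ`, `polyDerivOp p a F s = Σₖ pₖ aᵏ F⁽ᵏ⁾(s)` (sum over the support of `p`;
`F⁽ᵏ⁾ = iteratedDeriv k F`). With `a = −1/L` this is the `p(−L⁻¹ d/ds)` of Levinson's method.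
[cite: Conrey1983, §4] -/
def polyDerivOp (p : ℝ[X]) (a : ℝ) (F : ℂ → ℂ) (s : ℂ) : ℂ :=
  p.sum fun k c ↦ (c : ℂ) * (a : ℂ) ^ k * iteratedDeriv k F s

/-- Unfolding of `polyDerivOp` as a sum over the support. [folklore] -/
theorem polyDerivOp_def (p : ℝ[X]) (a : ℝ) (F : ℂ → ℂ) (s : ℂ) :
    polyDerivOp p a F s = ∑ k ∈ p.support, (p.coeff k : ℂ) * (a : ℂ) ^ k * iteratedDeriv k F s := by
  rw [polyDerivOp, Polynomial.sum_def]

/-- `polyDerivOp` is additive in the polynomial. [folklore] -/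
theorem polyDerivOp_add (p q : ℝ[X]) (a : ℝ) (F : ℂ → ℂ) (s : ℂ) :
    polyDerivOp (p + q) a F s = polyDerivOp p a F s + polyDerivOp q a F s := by
  unfold polyDerivOp
  exact Polynomial.sum_add_index p q _ (fun k ↦ by simp) (fun k b₁ b₂ ↦ by push_cast; ring)

/-- A constant polynomial acts as multiplication by the constant: `polyDerivOp (C c) a F = c F`.
[folklore] -/
theorem polyDerivOp_C (c a : ℝ) (F : ℂ → ℂ) (s : ℂ) : polyDerivOp (C c) a F s = c * F s := by
  unfold polyDerivOp
  rw [Polynomial.sum_C_index (by simp)]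
  simp [iteratedDeriv_zero]

/-- `polyDerivOp` of the zero polynomial vanishes. [folklore] -/
theorem polyDerivOp_zero (a : ℝ) (F : ℂ → ℂ) (s : ℂ) : polyDerivOp 0 a F s = 0 := by
  simp [polyDerivOp]

/-- `polyDerivOp p a F` is an entire function of `s` when `F` is entire. [folklore] -/
theorem differentiable_polyDerivOp (p : ℝ[X]) (a : ℝ) {F : ℂ → ℂ} (hF : Differentiable ℂ F) :
    Differentiable ℂ (polyDerivOp p a F) := by
  have h : (polyDerivOp p a F) = fun s ↦
      ∑ k ∈ p.support, (p.coeff k : ℂ) * (a : ℂ) ^ k * iteratedDeriv k F s := by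
    funext s; exact polyDerivOp_def p a F s
  rw [h]
  refine Differentiable.fun_sum fun k _ ↦ ?_
  exact ((hF.contDiff (n := ⊤)).differentiable_iteratedDeriv k
    (WithTop.coe_lt_top (k : ℕ∞))).const_mul _

/-! ## The reflection `F♯(s) = conj F(1 − s̄)` -/

/-- `1 − conj s = conj (1 − s)`. [folklore] -/
theorem one_sub_conj_eq (s : ℂ) : 1 - conj s = conj (1 - s) := by simp

/-- For entire `F`, `F♯(s) = conj F(1 − s̄)` is entire and
`deriv F♯ (s) = −conj (F'(1 − s̄))`. [folklore] -/
theorem hasDerivAt_conj_one_sub_conj {F : ℂ → ℂ} (hF : Differentiable ℂ F) (s : ℂ) :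
    HasDerivAt (fun s : ℂ ↦ conj (F (1 - conj s))) (-conj (deriv F (1 - conj s))) s := by
  have h1 : HasDerivAt (conj ∘ F ∘ conj) (conj (deriv F (1 - conj s))) (conj (1 - conj s)) :=
    (hF _).hasDerivAt.conj_conj
  have e1 : conj (1 - conj s) = 1 - s := by simp
  rw [e1] at h1
  have h2 : HasDerivAt (fun s : ℂ ↦ 1 - s) (-1) s := by
    simpa using (hasDerivAt_id s).const_sub 1
  have h := h1.comp s h2
  have e : (conj ∘ F ∘ conj) ∘ (fun s : ℂ ↦ 1 - s) = fun s : ℂ ↦ conj (F (1 - conj s)) := by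
    funext w; simp [Function.comp_def]
  rw [e, mul_neg_one] at h
  exact h

/-- `F♯` is entire when `F` is. [folklore] -/
theorem differentiable_conj_one_sub_conj {F : ℂ → ℂ} (hF : Differentiable ℂ F) :
    Differentiable ℂ (fun s : ℂ ↦ conj (F (1 - conj s))) := fun s ↦
  (hasDerivAt_conj_one_sub_conj hF s).differentiableAt

/-- **The reflection rule for derivatives**: for entire `F` and every `k`,
`(F♯)⁽ᵏ⁾(s) = (−1)ᵏ conj F⁽ᵏ⁾(1 − s̄)`. [folklore] -/
theorem iteratedDeriv_conj_one_sub_conj {F : ℂ → ℂ} (hF : Differentiable ℂ F) (k : ℕ) :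
    iteratedDeriv k (fun s : ℂ ↦ conj (F (1 - conj s))) =
      fun s ↦ (-1) ^ k * conj (iteratedDeriv k F (1 - conj s)) := by
  induction k with
  | zero => funext s; simp [iteratedDeriv_zero]
  | succ k ih =>
    have hFk : Differentiable ℂ (iteratedDeriv k F) :=
      (hF.contDiff (n := ⊤)).differentiable_iteratedDeriv k (WithTop.coe_lt_top (k : ℕ∞))
    rw [iteratedDeriv_succ, ih]
    funext s
    have h := (hasDerivAt_conj_one_sub_conj hFk s).const_mul ((-1 : ℂ) ^ k)
    rw [h.deriv, iteratedDeriv_succ, pow_succ]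
    ring

/-- **`conj (p(a d/ds) F)(1 − s̄) = (p(−a d/ds) F♯)(s)`** for entire `F` and real `p`, `a`: under
the reflection in the critical line the operator `p(a δ)` becomes `p(−a δ)`. [cite: Conrey1983, §4] -/
theorem conj_polyDerivOp_one_sub_conj (p : ℝ[X]) (a : ℝ) {F : ℂ → ℂ} (hF : Differentiable ℂ F) (s : ℂ) :
    conj (polyDerivOp p a F (1 - conj s)) =
      polyDerivOp p (-a) (fun s : ℂ ↦ conj (F (1 - conj s))) s := by
  rw [polyDerivOp_def, polyDerivOp_def, map_sum]
  refine Finset.sum_congr rfl fun k _ ↦ ?_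
  rw [iteratedDeriv_conj_one_sub_conj hF k]
  simp only [map_mul, map_pow, Complex.conj_ofReal]
  have hsq : ((-a : ℝ) : ℂ) ^ k * (-1) ^ k = (a : ℂ) ^ k := by
    rw [← mul_pow]
    congr 1
    push_cast
    ring
  linear_combination (-((p.coeff k : ℂ) * conj (iteratedDeriv k F (1 - conj s)))) * hsq

end Literature.Analysis.Complex

end
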